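import Summits.CriticalPhenomena.PercolationContinuityZ3.Theorems.PercNearOneGluingNoHeavyLowerTailThreePointProductFormFibreSeriesPieceMarks
import Summits.CriticalPhenomena.PercolationContinuityZ3.Theorems.PercNearOneGluingNoHeavyLowerTailThreePointProductFormFibreParallelFamilyFlat
import Summits.CriticalPhenomena.PercolationContinuityZ3.Theorems.PercNearOneGluingNoHeavyLowerTailThreePointProductFormTreeRecursionTrunk
import HarnessLib

/-!
# (P) on tree-like fibres, I: conversions (Sahi programme, prover prim-sahi-p2 gen 59)

Support file (`--supports stmt-CriticalPhenomena-4575`, helper).  Standard axioms, no sorries, no named facts, no definitions.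
Memo `run/shared/lean/prim/prim-sahi/FROM-prim-sahi-p2-gen59-ONE-STEP-LEMMA.md` §2, §8(2); `prim-sahi-p2/PROOF-E3.md` (68j), §69.

For a piece with mask `m` and apex `a`: `#good + G1 = Ga + Gb` (`card_good_add_G1`), `#bad + #good = #S0` (`card_bad_add_good`, `bad` spelled as in
`…ThreePointProductFormFibreCutVertex` with the restricted flat), `#P1 + #S0 = #(S0∪P1)`, `#P2 + #S0 = #(S0∪P2)` (`card_P1_add_S0`, `card_P2_add_S0`)
— the dictionary between the six multiplicative statistics and `(#bad, #P1, #P2)` of CONJECTURE (P).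
[this work] (gen 59).
-/

namespace Summit.CriticalPhenomena.PercolationContinuityZ3.Theorems.ProductFormFibre

open Finset Literature.Probability.Percolation
open Summit.CriticalPhenomena.PercolationContinuityZ3.Theorems.ThreePointCPIClusterSwap (clusterFlip)

variable {V α : Type*}

/-! ### 1. Conversions between the six statistics and `(#bad, #P1, #P2)` -/

section Conversions

variable [Fintype α] [DecidableEq α] (ends : α → Sym2 V) (s a c : V) (m : α → Bool)

open Classical in
/-- Inclusion–exclusion for the good states: `#good + G1 = Ga + Gb` (`good = Ga ∪ Gb`, `G1 = Ga ∩ Gb`). [this work] -/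
theorem card_good_add_G1 :
    (univ.filter fun z : α → Bool =>
        (((¬ (openGraph (labelledOpen ends (fun y => z y && m y))).Reachable s a ∧
        ¬ (openGraph (labelledOpen ends (fun y => z y && m y))).Reachable s c) ∧
        (¬ (openGraph (labelledOpen ends (fun y => z y && m y))).Reachable c a ∧
        ¬ (openGraph (labelledOpen ends (fun y => z y && m y))).Reachable c s)) ∧
        ¬ (openGraph (labelledOpen ends (fun l =>
          clusterFlip ends a (fun y => !(z y && m y)) l && m l))).Reachable c s)).card +
    (univ.filter fun z : α → Bool =>
        (((¬ (openGraph (labelledOpen ends (fun y => z y && m y))).Reachable s a ∧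
        ¬ (openGraph (labelledOpen ends (fun y => z y && m y))).Reachable s c) ∧
        (¬ (openGraph (labelledOpen ends (fun y => z y && m y))).Reachable c a ∧
        ¬ (openGraph (labelledOpen ends (fun y => z y && m y))).Reachable c s)) ∧
        ((¬ (openGraph (labelledOpen ends (fun l =>
          clusterFlip ends a (fun y => !(z y && m y)) l && m l))).Reachable s a ∧
        ¬ (openGraph (labelledOpen ends (fun l =>
          clusterFlip ends a (fun y => !(z y && m y)) l && m l))).Reachable s c) ∧
        (¬ (openGraph (labelledOpen ends (fun l =>
          clusterFlip ends a (fun y => !(z y && m y)) l && m l))).Reachable c a ∧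
        ¬ (openGraph (labelledOpen ends (fun l =>
          clusterFlip ends a (fun y => !(z y && m y)) l && m l))).Reachable c s)))).card =
    (univ.filter fun z : α → Bool =>
        (((¬ (openGraph (labelledOpen ends (fun y => z y && m y))).Reachable s a ∧
        ¬ (openGraph (labelledOpen ends (fun y => z y && m y))).Reachable s c) ∧
        (¬ (openGraph (labelledOpen ends (fun y => z y && m y))).Reachable c a ∧
        ¬ (openGraph (labelledOpen ends (fun y => z y && m y))).Reachable c s)) ∧
        (¬ (openGraph (labelledOpen ends (fun l =>
          clusterFlip ends a (fun y => !(z y && m y)) l && m l))).Reachable c a ∧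
        ¬ (openGraph (labelledOpen ends (fun l =>
          clusterFlip ends a (fun y => !(z y && m y)) l && m l))).Reachable c s))).card +
    (univ.filter fun z : α → Bool =>
        (((¬ (openGraph (labelledOpen ends (fun y => z y && m y))).Reachable s a ∧
        ¬ (openGraph (labelledOpen ends (fun y => z y && m y))).Reachable s c) ∧
        (¬ (openGraph (labelledOpen ends (fun y => z y && m y))).Reachable c a ∧
        ¬ (openGraph (labelledOpen ends (fun y => z y && m y))).Reachable c s)) ∧
        (¬ (openGraph (labelledOpen ends (fun l =>
          clusterFlip ends a (fun y => !(z y && m y)) l && m l))).Reachable s a ∧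
        ¬ (openGraph (labelledOpen ends (fun l =>
          clusterFlip ends a (fun y => !(z y && m y)) l && m l))).Reachable s c))).card := by
  have hU : (univ.filter fun z : α → Bool =>
        (((¬ (openGraph (labelledOpen ends (fun y => z y && m y))).Reachable s a ∧
        ¬ (openGraph (labelledOpen ends (fun y => z y && m y))).Reachable s c) ∧
        (¬ (openGraph (labelledOpen ends (fun y => z y && m y))).Reachable c a ∧
        ¬ (openGraph (labelledOpen ends (fun y => z y && m y))).Reachable c s)) ∧
        ¬ (openGraph (labelledOpen ends (fun l =>
          clusterFlip ends a (fun y => !(z y && m y)) l && m l))).Reachable c s)) =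
      (univ.filter fun z : α → Bool =>
        (((¬ (openGraph (labelledOpen ends (fun y => z y && m y))).Reachable s a ∧
        ¬ (openGraph (labelledOpen ends (fun y => z y && m y))).Reachable s c) ∧
        (¬ (openGraph (labelledOpen ends (fun y => z y && m y))).Reachable c a ∧
        ¬ (openGraph (labelledOpen ends (fun y => z y && m y))).Reachable c s)) ∧
        (¬ (openGraph (labelledOpen ends (fun l =>
          clusterFlip ends a (fun y => !(z y && m y)) l && m l))).Reachable c a ∧
        ¬ (openGraph (labelledOpen ends (fun l =>
          clusterFlip ends a (fun y => !(z y && m y)) l && m l))).Reachable c s))) ∪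
      (univ.filter fun z : α → Bool =>
        (((¬ (openGraph (labelledOpen ends (fun y => z y && m y))).Reachable s a ∧
        ¬ (openGraph (labelledOpen ends (fun y => z y && m y))).Reachable s c) ∧
        (¬ (openGraph (labelledOpen ends (fun y => z y && m y))).Reachable c a ∧
        ¬ (openGraph (labelledOpen ends (fun y => z y && m y))).Reachable c s)) ∧
        (¬ (openGraph (labelledOpen ends (fun l =>
          clusterFlip ends a (fun y => !(z y && m y)) l && m l))).Reachable s a ∧
        ¬ (openGraph (labelledOpen ends (fun l =>
          clusterFlip ends a (fun y => !(z y && m y)) l && m l))).Reachable s c))) := by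
    ext z
    simp only [Finset.mem_filter, Finset.mem_union, Finset.mem_univ, true_and]
    constructor
    · rintro ⟨hS, hg⟩
      by_cases hca' : (openGraph (labelledOpen ends (fun l =>
          clusterFlip ends a (fun y => !(z y && m y)) l && m l))).Reachable c a
      · exact Or.inr ⟨hS, fun h => hg (hca'.trans h.symm), fun h => hg h.symm⟩
      · exact Or.inl ⟨hS, hca', hg⟩
    · rintro (⟨hS, h1, h2⟩ | ⟨hS, h1, h2⟩)
      · exact ⟨hS, h2⟩
      · exact ⟨hS, fun h => h2 h.symm⟩
  have hI : (univ.filter fun z : α → Bool =>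
        (((¬ (openGraph (labelledOpen ends (fun y => z y && m y))).Reachable s a ∧
        ¬ (openGraph (labelledOpen ends (fun y => z y && m y))).Reachable s c) ∧
        (¬ (openGraph (labelledOpen ends (fun y => z y && m y))).Reachable c a ∧
        ¬ (openGraph (labelledOpen ends (fun y => z y && m y))).Reachable c s)) ∧
        ((¬ (openGraph (labelledOpen ends (fun l =>
          clusterFlip ends a (fun y => !(z y && m y)) l && m l))).Reachable s a ∧
        ¬ (openGraph (labelledOpen ends (fun l =>
          clusterFlip ends a (fun y => !(z y && m y)) l && m l))).Reachable s c) ∧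
        (¬ (openGraph (labelledOpen ends (fun l =>
          clusterFlip ends a (fun y => !(z y && m y)) l && m l))).Reachable c a ∧
        ¬ (openGraph (labelledOpen ends (fun l =>
          clusterFlip ends a (fun y => !(z y && m y)) l && m l))).Reachable c s)))) =
      (univ.filter fun z : α → Bool =>
        (((¬ (openGraph (labelledOpen ends (fun y => z y && m y))).Reachable s a ∧
        ¬ (openGraph (labelledOpen ends (fun y => z y && m y))).Reachable s c) ∧
        (¬ (openGraph (labelledOpen ends (fun y => z y && m y))).Reachable c a ∧
        ¬ (openGraph (labelledOpen ends (fun y => z y && m y))).Reachable c s)) ∧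
        (¬ (openGraph (labelledOpen ends (fun l =>
          clusterFlip ends a (fun y => !(z y && m y)) l && m l))).Reachable c a ∧
        ¬ (openGraph (labelledOpen ends (fun l =>
          clusterFlip ends a (fun y => !(z y && m y)) l && m l))).Reachable c s))) ∩
      (univ.filter fun z : α → Bool =>
        (((¬ (openGraph (labelledOpen ends (fun y => z y && m y))).Reachable s a ∧
        ¬ (openGraph (labelledOpen ends (fun y => z y && m y))).Reachable s c) ∧
        (¬ (openGraph (labelledOpen ends (fun y => z y && m y))).Reachable c a ∧
        ¬ (openGraph (labelledOpen ends (fun y => z y && m y))).Reachable c s)) ∧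
        (¬ (openGraph (labelledOpen ends (fun l =>
          clusterFlip ends a (fun y => !(z y && m y)) l && m l))).Reachable s a ∧
        ¬ (openGraph (labelledOpen ends (fun l =>
          clusterFlip ends a (fun y => !(z y && m y)) l && m l))).Reachable s c))) := by
    ext z
    simp only [Finset.mem_filter, Finset.mem_inter, Finset.mem_univ, true_and]
    constructor
    · rintro ⟨hS, h1, h2⟩; exact ⟨⟨hS, h2⟩, ⟨hS, h1⟩⟩
    · rintro ⟨⟨hS, h2⟩, ⟨-, h1⟩⟩; exact ⟨hS, h1, h2⟩
  rw [hU, hI]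
  exact Finset.card_union_add_card_inter _ _

open Classical in
/-- `#bad + #good = #S0` (`bad`, in the standard spelling with the restricted flat, and `good` partition `S0`). [this work] -/
theorem card_bad_add_good :
    (univ.filter fun z : α → Bool =>
        ((¬ (openGraph (labelledOpen ends (fun y => z y && m y))).Reachable a s ∧ ¬ (openGraph (labelledOpen ends (fun y => z y && m y))).Reachable a c ∧
          ¬ (openGraph (labelledOpen ends (fun y => z y && m y))).Reachable s c) ∧
        (openGraph (labelledOpen ends (fun l =>
          clusterFlip ends a (fun y => !(z y && m y)) l && m l))).Reachable s c)).card +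
    (univ.filter fun z : α → Bool =>
        (((¬ (openGraph (labelledOpen ends (fun y => z y && m y))).Reachable s a ∧
        ¬ (openGraph (labelledOpen ends (fun y => z y && m y))).Reachable s c) ∧
        (¬ (openGraph (labelledOpen ends (fun y => z y && m y))).Reachable c a ∧
        ¬ (openGraph (labelledOpen ends (fun y => z y && m y))).Reachable c s)) ∧
        ¬ (openGraph (labelledOpen ends (fun l =>
          clusterFlip ends a (fun y => !(z y && m y)) l && m l))).Reachable c s)).card =
    (univ.filter fun z : α → Bool =>
        ((¬ (openGraph (labelledOpen ends (fun y => z y && m y))).Reachable s a ∧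
        ¬ (openGraph (labelledOpen ends (fun y => z y && m y))).Reachable s c) ∧
        (¬ (openGraph (labelledOpen ends (fun y => z y && m y))).Reachable c a ∧
        ¬ (openGraph (labelledOpen ends (fun y => z y && m y))).Reachable c s))).card := by
  rw [← Finset.card_union_of_disjoint, ← Finset.filter_or]
  · refine congrArg Finset.card (Finset.filter_congr fun z _ => ?_)
    constructor
    · rintro (⟨⟨h1, h2, h3⟩, -⟩ | ⟨hS, -⟩)
      · exact ⟨⟨fun h => h1 h.symm, h3⟩, ⟨fun h => h2 h.symm, fun h => h3 h.symm⟩⟩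
      · exact hS
    · rintro ⟨⟨h1, h2⟩, ⟨h3, h4⟩⟩
      by_cases hf : (openGraph (labelledOpen ends (fun l =>
          clusterFlip ends a (fun y => !(z y && m y)) l && m l))).Reachable s c
      · exact Or.inl ⟨⟨fun h => h1 h.symm, fun h => h3 h.symm, h2⟩, hf⟩
      · exact Or.inr ⟨⟨⟨h1, h2⟩, ⟨h3, h4⟩⟩, fun h => hf h.symm⟩
  · rw [Finset.disjoint_filter]
    rintro z - ⟨-, hf⟩ ⟨-, hg⟩
    exact hg hf.symm

open Classical in
/-- `#P1 + #S0 = #isoC` (`P1 = {a ↔ s, a ↮ c}` and `S0` partition 'c isolated'). [this work] -/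
theorem card_P1_add_S0 :
    (univ.filter fun z : α → Bool =>
        ((openGraph (labelledOpen ends (fun y => z y && m y))).Reachable a s ∧ ¬ (openGraph (labelledOpen ends (fun y => z y && m y))).Reachable a c)).card +
    (univ.filter fun z : α → Bool =>
        ((¬ (openGraph (labelledOpen ends (fun y => z y && m y))).Reachable s a ∧
        ¬ (openGraph (labelledOpen ends (fun y => z y && m y))).Reachable s c) ∧
        (¬ (openGraph (labelledOpen ends (fun y => z y && m y))).Reachable c a ∧
        ¬ (openGraph (labelledOpen ends (fun y => z y && m y))).Reachable c s))).card =
    (univ.filter fun z : α → Bool =>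
        (¬ (openGraph (labelledOpen ends (fun y => z y && m y))).Reachable c a ∧
        ¬ (openGraph (labelledOpen ends (fun y => z y && m y))).Reachable c s)).card := by
  rw [← Finset.card_union_of_disjoint, ← Finset.filter_or]
  · refine congrArg Finset.card (Finset.filter_congr fun z _ => ?_)
    constructor
    · rintro (⟨h1, h2⟩ | ⟨-, hC⟩)
      · exact ⟨fun h => h2 h.symm, fun h => h2 (h1.trans h.symm)⟩
      · exact hC
    · rintro ⟨h1, h2⟩
      by_cases has : (openGraph (labelledOpen ends (fun y => z y && m y))).Reachable a s
      · exact Or.inl ⟨has, fun h => h1 h.symm⟩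
      · exact Or.inr ⟨⟨fun h => has h.symm, fun h => h2 h.symm⟩, ⟨h1, h2⟩⟩
  · rw [Finset.disjoint_filter]
    rintro z - ⟨h1, -⟩ ⟨⟨h2, -⟩, -⟩
    exact h2 h1.symm

open Classical in
/-- `#P2 + #S0 = #isoS`. [this work] -/
theorem card_P2_add_S0 :
    (univ.filter fun z : α → Bool =>
        ((openGraph (labelledOpen ends (fun y => z y && m y))).Reachable a c ∧ ¬ (openGraph (labelledOpen ends (fun y => z y && m y))).Reachable a s)).card +
    (univ.filter fun z : α → Bool =>
        ((¬ (openGraph (labelledOpen ends (fun y => z y && m y))).Reachable s a ∧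
        ¬ (openGraph (labelledOpen ends (fun y => z y && m y))).Reachable s c) ∧
        (¬ (openGraph (labelledOpen ends (fun y => z y && m y))).Reachable c a ∧
        ¬ (openGraph (labelledOpen ends (fun y => z y && m y))).Reachable c s))).card =
    (univ.filter fun z : α → Bool =>
        (¬ (openGraph (labelledOpen ends (fun y => z y && m y))).Reachable s a ∧
        ¬ (openGraph (labelledOpen ends (fun y => z y && m y))).Reachable s c)).card := by
  rw [← Finset.card_union_of_disjoint, ← Finset.filter_or]
  · refine congrArg Finset.card (Finset.filter_congr fun z _ => ?_)
    constructor
    · rintro (⟨h1, h2⟩ | ⟨hS, -⟩)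
      · exact ⟨fun h => h2 h.symm, fun h => h2 (h1.trans h.symm)⟩
      · exact hS
    · rintro ⟨h1, h2⟩
      by_cases hac : (openGraph (labelledOpen ends (fun y => z y && m y))).Reachable a c
      · exact Or.inl ⟨hac, fun h => h1 h.symm⟩
      · exact Or.inr ⟨⟨h1, h2⟩, ⟨fun h => hac h.symm, fun h => h2 h.symm⟩⟩
  · rw [Finset.disjoint_filter]
    rintro z - ⟨h1, -⟩ ⟨⟨_, -⟩, ⟨h2, -⟩⟩
    exact h2 h1.symm

end Conversions

end Summit.CriticalPhenomena.PercolationContinuityZ3.Theorems.ProductFormFibre
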